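import Mathlib
import HarnessLib
import Summits.HubbardSuperconductivity.HubbardSuperconductivity.Theorems.KLProgrammeKLRegimeFlowPieceJetsOfReadJets
import Summits.HubbardSuperconductivity.HubbardSuperconductivity.Theorems.KLProgrammeKLRegimeSplitGenericV2
import Summits.HubbardSuperconductivity.HubbardSuperconductivity.Theorems.KLProgrammeKLRegimeSplitFrameExtFnConst

/-!
# K3 under scheme F (K3-FLOW RULING, plan g16): the renormalisation child's JETS STEP packaged in the closer's binder shape —
# the G-only frame table `ctRenF G`, the smallness `flowUJ G Q`, and `flowPieceJets_step_generic`

Cell gate-hubbard-kl, seat hubbard-kl-k3c3-p3 (g5; S4(b)).  k3c3-p2 g6's forward-induction closer of child 2-F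
(`countertermP2_klPredsV17F_of_jetsStep`, HOME/hubbard-kl-k3c3-p2/g6/KLProgrammeKLRegimeRenormFlowV17F.lean, KL STATUS 10:33:18Z) is complete modulo
`hJ : ∀ G Q, G.WF → Q.WF → ∃ UJ > 0, ∀ L M β U μ n, 0 < U → U ≤ UJ → klBetaMin ≤ β → μ ∈ klWindowC → TwoLegReadJetsF L M G Q β U μ n →
FlowPieceJetsAt L M β U μ (Rf G) n` for a G-only table `Rf`.  This file supplies everything in that shape EXCEPT the two V17F predicate names (the bundle
`…SplitSlotsV17F` is not in the tree yet): with `TwoLegReadJetsF`/`FlowPieceJetsAt` unfolded (reading jets of `ν_n(K)` at ANY frame `K`; jets of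
`jacksonFrame d (klFrameExtFn μ ν_n(K))` at ANY degree `d`), `hJ` is the instance `K := klFlowFrameU L M β U μ n`, `d := klFlowDeg n`.

* §1 `klCutoffX4` — a definite bound `≥ 1` for `‖Dˡχ₂‖`, `l ≤ 4` (`exists_norm_iteratedFDeriv_salmhoferCutoff_le_all 4` by choice);
* §2 **`flowGfr G j := 2·curveExtC klCutoffX4 G.S j + 1`**, **`ctRenF G : RenConsts := ⟨32·(G.S 0 + 1), 1, flowGfr G⟩`**, `ctRenF_WF2`, `ctRenF_cr`
  (`G.S 0 + 1 ≤ (ctRenF G).cr / 32`), **`flowUJ G Q := (Σ_{j<5} curveExtC klCutoffX4 Q.S' j + 1)⁻¹`**, `flowUJ_pos`, the fit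
  `curveExtC X G.S j + curveExtC X Q.S' j·|U| ≤ flowGfr G j` for `|U| ≤ flowUJ G Q`;
* §3 **`flowPieceJets_step_generic`**: `∀ G Q, G.WF → Q.WF → ∃ UJ > 0, ∀ L M β U μ K n d, 0 < U → U ≤ UJ → μ ∈ klWindowC →
  (ContDiff ℝ 4 ν_n(K) ∧ ∀ k ≤ 4, |∂^k ν_n(K)| ≤ curveJetBar G.S Q.S' U k n) → ∀ j ≤ 4, ∀ q, ‖Dʲ evalM (jacksonFrame d (klFrameExtFn μ ν_n(K))) q‖ ≤
  (ctRenF G).Gfr j·uPow j U·4^{(j−2)n}` (with `UJ := flowUJ G Q`; `klBetaMin ≤ β` not needed).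

Proofs + three closed-form tables; nothing about the model is asserted.  References: BGM 2006 §2.2 (2.23), §2.4 (2.36) [cite: BenfattoGiulianiMastropietro2006].
-/

noncomputable section

namespace Summit.HubbardSuperconductivity.HubbardSuperconductivity.Theorems.KLRegimeSplit

set_option linter.dupNamespace false -- summit = problem name (single-conjunct summit), D-0017

open Real Finset MeasureTheory Literature.MathematicalPhysics.QuantumLattice Literature.MathematicalPhysics.QuantumLattice.FermiRG
open Literature.Probability.LatticeModels
open Summit.HubbardSuperconductivity.HubbardSuperconductivity.Theorems.PerturbedFermiCurve

/-! ## §1 A definite cutoff-derivative bound up to order 4 -/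

/-- **`klCutoffX4`** — a definite real `≥ 1` bounding `‖Dˡ χ₂‖` for `l ≤ 4` (chosen from `exists_norm_iteratedFDeriv_salmhoferCutoff_le_all 4`). -/
def klCutoffX4 : ℝ := Classical.choose (exists_norm_iteratedFDeriv_salmhoferCutoff_le_all 4)

/-- `1 ≤ klCutoffX4`. -/
theorem one_le_klCutoffX4 : 1 ≤ klCutoffX4 := (Classical.choose_spec (exists_norm_iteratedFDeriv_salmhoferCutoff_le_all 4)).1

/-- `‖Dˡ χ₂ x‖ ≤ klCutoffX4` for `l ≤ 4`. -/
theorem norm_iteratedFDeriv_salmhoferCutoff_le_klCutoffX4 : ∀ l ≤ 4, ∀ x : ℝ, ‖iteratedFDeriv ℝ l salmhoferCutoff x‖ ≤ klCutoffX4 :=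
  (Classical.choose_spec (exists_norm_iteratedFDeriv_salmhoferCutoff_le_all 4)).2

/-- `0 ≤ klCutoffX4`. -/
theorem klCutoffX4_nonneg : 0 ≤ klCutoffX4 := zero_le_one.trans one_le_klCutoffX4

/-! ## §2 The G-only frame table of scheme F and the coupling threshold -/

/-- **`flowGfr G j := 2·curveExtC klCutoffX4 G.S j + 1`** — the admissible-piece allowances of the flow, from the engine's leading jet sizes `G.S`. -/
def flowGfr (G : GeoConsts) (j : ℕ) : ℝ := 2 * curveExtC klCutoffX4 G.S j + 1

/-- **`ctRenF G`** — the renormalisation package of scheme F: `cr := 32·(G.S 0 + 1)`, `cz := 1`, `Gfr := flowGfr G`. -/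
def ctRenF (G : GeoConsts) : RenConsts := ⟨32 * (G.S 0 + 1), 1, flowGfr G⟩

/-- Unfolding `(ctRenF G).Gfr`. -/
theorem ctRenF_Gfr (G : GeoConsts) (j : ℕ) : (ctRenF G).Gfr j = flowGfr G j := rfl

/-- Unfolding `(ctRenF G).cr`. -/
theorem ctRenF_cr_eq (G : GeoConsts) : (ctRenF G).cr = 32 * (G.S 0 + 1) := rfl

/-- Unfolding `(ctRenF G).cz`. -/
theorem ctRenF_cz_eq (G : GeoConsts) : (ctRenF G).cz = 1 := rfl

/-- The sign accessor `0 ≤ G.S j` of `G.WF`. -/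
theorem GeoConsts.WF.S_nonneg' {G : GeoConsts} (hG : G.WF) : ∀ j, 0 ≤ G.S j := hG.2.2.2.2.2.2.2.2.2.2.2.2.2.2.2.2.2.1

/-- The sign accessor `0 ≤ Q.S' j` of `Q.WF`. -/
theorem EngConsts.WF.S'_nonneg' {Q : EngConsts} (hQ : Q.WF) : ∀ j, 0 ≤ Q.S' j := hQ.2.2.2.2.1

/-- `flowGfr G j ≥ 1 > 0` for well-formed `G`. -/
theorem flowGfr_pos {G : GeoConsts} (hG : G.WF) (j : ℕ) : 0 < flowGfr G j := by
  have h := curveExtC_nonneg klCutoffX4_nonneg (GeoConsts.WF.S_nonneg' hG) j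
  unfold flowGfr; linarith

/-- **`ctRenF G` is well formed** (`WF2`: signs, `0 < cr`, `0 < cz`). -/
theorem ctRenF_WF2 (G : GeoConsts) (hG : G.WF) : (ctRenF G).WF2 := by
  have hS0 := GeoConsts.WF.S_nonneg' hG 0
  refine ⟨⟨?_, ?_, fun j => (flowGfr_pos hG j).le⟩, ?_, ?_⟩
  · show 0 ≤ 32 * (G.S 0 + 1); positivity
  · show (0 : ℝ) ≤ 1; norm_num
  · show 0 < 32 * (G.S 0 + 1); positivity
  · show (0 : ℝ) < 1; norm_num

/-- **The tolerance room** k3c3-p2's closer asks of the table: `G.S 0 + 1 ≤ (ctRenF G).cr / 32`. -/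
theorem ctRenF_cr (G : GeoConsts) (_hG : G.WF) : G.S 0 + 1 ≤ (ctRenF G).cr / 32 := by
  rw [ctRenF_cr_eq]; linarith

/-- **`flowUJ G Q := (Σ_{j<5} curveExtC klCutoffX4 Q.S' j + 1)⁻¹`** — the coupling threshold of the jets step. -/
def flowUJ (_G : GeoConsts) (Q : EngConsts) : ℝ := (∑ j ∈ range 5, curveExtC klCutoffX4 Q.S' j + 1)⁻¹

/-- `0 < flowUJ G Q` for well-formed `Q`. -/
theorem flowUJ_pos (G : GeoConsts) {Q : EngConsts} (hQ : Q.WF) : 0 < flowUJ G Q := by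
  unfold flowUJ
  have h : 0 ≤ ∑ j ∈ range 5, curveExtC klCutoffX4 Q.S' j :=
    sum_nonneg fun j _ => curveExtC_nonneg klCutoffX4_nonneg (EngConsts.WF.S'_nonneg' hQ) j
  positivity

/-- **The fit at the table**: for `0 ≤ U ≤ flowUJ G Q` and `j ≤ 4`, `curveExtC klCutoffX4 G.S j + curveExtC klCutoffX4 Q.S' j·|U| ≤ flowGfr G j`. -/
theorem flow_fit {G : GeoConsts} {Q : EngConsts} (hG : G.WF) (hQ : Q.WF) {U : ℝ} (hU0 : 0 ≤ U) (hU : U ≤ flowUJ G Q) {j : ℕ} (hj : j ≤ 4) :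
    curveExtC klCutoffX4 G.S j + curveExtC klCutoffX4 Q.S' j * |U| ≤ flowGfr G j := by
  have hcG := curveExtC_nonneg klCutoffX4_nonneg (GeoConsts.WF.S_nonneg' hG) j
  have hcQ : ∀ i, 0 ≤ curveExtC klCutoffX4 Q.S' i := fun i => curveExtC_nonneg klCutoffX4_nonneg (EngConsts.WF.S'_nonneg' hQ) i
  set T : ℝ := ∑ i ∈ range 5, curveExtC klCutoffX4 Q.S' i + 1 with hT
  have hT0 : 0 < T := by have := sum_nonneg fun i (_ : i ∈ range 5) => hcQ i; rw [hT]; linarith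
  have hle : curveExtC klCutoffX4 Q.S' j ≤ T := by
    have hmem : j ∈ range 5 := mem_range.mpr (by omega)
    have h1 := single_le_sum (f := fun i => curveExtC klCutoffX4 Q.S' i) (fun i _ => hcQ i) hmem
    rw [hT]; linarith
  have habs : |U| = U := abs_of_nonneg hU0
  have hUT : curveExtC klCutoffX4 Q.S' j * |U| ≤ 1 := by
    rw [habs]
    calc curveExtC klCutoffX4 Q.S' j * U ≤ T * flowUJ G Q := mul_le_mul hle hU hU0 hT0.le
      _ = 1 := by rw [hT]; unfold flowUJ; exact mul_inv_cancel₀ (ne_of_gt hT0)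
  unfold flowGfr; linarith

/-! ## §3 The jets step in the closer's binder shape -/

section Model

/-- **`flowPieceJets_step_generic`** — for every `(G, Q)` well formed there is `UJ > 0` (`= flowUJ G Q`) such that, in every volume, for every
frame `K`, scale `n`, degree `d`, `0 < U ≤ UJ`, `μ ∈ klWindowC`: reading jets of `ν_n(K)` within `curveJetBar G.S Q.S' U k n` (`k ≤ 4`, `ν_n(K)` `C⁴`)
give `‖Dʲ evalM (jacksonFrame d (klFrameExtFn μ ν_n(K))) q‖ ≤ (ctRenF G).Gfr j·uPow j U·4^{(j−2)n}` for `j ≤ 4` — i.e. `TwoLegReadJetsF … n →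
FlowPieceJetsAt … (ctRenF G) n` at `K := K_n`, `d := klFlowDeg n`. -/
theorem flowPieceJets_step_generic (G : GeoConsts) (Q : EngConsts) (hG : G.WF) (hQ : Q.WF) :
    ∃ UJ : ℝ, 0 < UJ ∧ ∀ (L M : ℕ) [NeZero L] [NeZero M] (β U μ : ℝ) (K : TrigPolyC4v) (n d : ℕ), 0 < U → U ≤ UJ → μ ∈ klWindowC →
      (ContDiff ℝ 4 (fun θ : ℝ => klLocalPart L M β U μ K n θ) ∧
        ∀ k ≤ 4, ∀ θ : ℝ, |iteratedDeriv k (fun θ : ℝ => klLocalPart L M β U μ K n θ) θ| ≤ curveJetBar G.S Q.S' U k n) →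
      ∀ j ≤ 4, ∀ q : Momentum,
        ‖iteratedFDeriv ℝ j (evalM (jacksonFrame d (klFrameExtFn μ (fun θ : ℝ => klLocalPart L M β U μ K n θ)))) q‖ ≤
          (ctRenF G).Gfr j * uPow j U * (4 : ℝ) ^ (((j : ℤ) - 2) * n) := by
  refine ⟨flowUJ G Q, flowUJ_pos G hQ, fun L M _ _ β U μ K n d hU hUJ hμ hread j hj q => ?_⟩
  have hfit : ∀ j ≤ 4, curveExtC klCutoffX4 G.S j + curveExtC klCutoffX4 Q.S' j * |U| ≤ (ctRenF G).Gfr j :=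
    fun j hj => by rw [ctRenF_Gfr]; exact flow_fit hG hQ hU.le hUJ hj
  exact norm_iteratedFDeriv_evalM_jacksonFrame_klFrameExtFn_le_pieceBar (GeoConsts.WF.S_nonneg' hG) (EngConsts.WF.S'_nonneg' hQ) hμ
    hread.1 hread.2 norm_iteratedFDeriv_salmhoferCutoff_le_klCutoffX4 hfit d hj q

end Model

end Summit.HubbardSuperconductivity.HubbardSuperconductivity.Theorems.KLRegimeSplit

end
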